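import Summits.Ventures.PercRepro.RankDistTight

/-!
# PercRepro — the INDEPENDENT part of the shadow profile is SYMMETRIC on the tight layer (p9, gen 19)

On the tight layer `|E| = p + q`, `ρ(E) = p`, split the shadow level `∂_u 𝓑` (`shadowLev M u (PerFlat.Uq M p q)`)
into its INDEPENDENT members (`|A| = u`) and its dependent ones: `s_u = i_u + d_u`. An independent shadow set
`A ⊇ B` (`B` a bottom set, `E ∖ B` a base) has an independent complement `E ∖ A ⊆ E ∖ B`, and `E ∖ A` contains a
bottom set: extend `A` to a base `β'`, then `E ∖ β' ⊆ E ∖ A` is a bottom set (it is inside the base `E ∖ B`, has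
`q` elements, and its complement `β'` is a base). So complementation is an involution between the independent
shadow sets of rank `u` and those of rank `p + q − u` — **`card_indepShadow_symm`: `i_u = i_{p+q−u}`** for every
`u ≤ p + q`. Hence the symmetry leg `s_u ≥ s_{p+q−u}` of the tight layer is exactly `d_u ≥ d_{p+q−u}` for the
DEPENDENT shadow sets (`symm_iff_dep_symm`). Nothing here is a statement about any window of the crux.
-/

namespace PercRepro.RankDist

open Set Finset _root_.Matroid PercRepro.ThmH

variable {α : Type} [DecidableEq α] (M : Matroid α) [M.Finite]

open scoped Classical in
/-- `i_u`: the independent shadow sets of rank `u`. -/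
noncomputable def indepShadow (p q u : ℕ) : Finset (Set α) :=
  (shadowLev M u (PerFlat.Uq M p q)).filter (fun A => M.Indep A)

open scoped Classical in
/-- `d_u`: the dependent shadow sets of rank `u`. -/
noncomputable def depShadow (p q u : ℕ) : Finset (Set α) :=
  (shadowLev M u (PerFlat.Uq M p q)).filter (fun A => ¬ M.Indep A)

open scoped Classical in
/-- `s_u = i_u + d_u`. -/
theorem card_shadowLev_eq_indep_add_dep (p q u : ℕ) :
    (shadowLev M u (PerFlat.Uq M p q)).card = (indepShadow M p q u).card + (depShadow M p q u).card := by
  unfold indepShadow depShadow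
  rw [Finset.card_filter_add_card_filter_not]

open scoped Classical in
/-- Membership in `indepShadow`. -/
lemma mem_indepShadow {p q u : ℕ} {A : Set α} :
    A ∈ indepShadow M p q u ↔ A ∈ shadowLev M u (PerFlat.Uq M p q) ∧ M.Indep A := by
  unfold indepShadow
  rw [Finset.mem_filter]

/-- **The complement of an independent shadow set of rank `u` is an independent shadow set of rank
`p + q − u`** (tight layer). -/
theorem compl_mem_indepShadow {p q u : ℕ} (hn : (gr M).card = p + q) (hr : M.eRank = (p : ℕ∞))
    {A : Set α} (hA : A ∈ indepShadow M p q u) : M.E \ A ∈ indepShadow M p q (p + q - u) := by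
  rw [mem_indepShadow] at hA ⊢
  obtain ⟨hA, hAind⟩ := hA
  rw [mem_shadowLev] at hA
  obtain ⟨hAE, hAu, B, hB, hBA⟩ := hA
  rw [mem_Uq_tight M hn hr] at hB
  obtain ⟨hBE, -, hBq, hD⟩ := hB
  have hfinA : A.Finite := M.ground_finite.subset hAE
  have hDcoe : ((gr M \ B : Finset α) : Set α) = M.E \ B := by rw [Finset.coe_sdiff, coe_gr]
  -- `E ∖ A ⊆ E ∖ B`, a base: independent
  have hsub : M.E \ A ⊆ M.E \ (B : Set α) := Set.sdiff_subset_sdiff_right hBA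
  have hcompl_ind : M.Indep (M.E \ A) := by
    have := hD.indep
    rw [hDcoe] at this
    exact this.subset hsub
  -- `|A| = u`
  have hAcard : A.ncard = u := by
    have h1 := hAind.eRk_eq_encard
    rw [eRk_eq_coe_rk M hAE, hAu, ← hfinA.cast_ncard_eq] at h1
    exact_mod_cast h1.symm
  have hEcard : M.E.ncard = p + q := by rw [← card_gr, hn]
  -- extend `A` to a base `β'`; `E ∖ β'` is a bottom set inside `E ∖ A`
  obtain ⟨β', hβ', hAβ'⟩ := hAind.exists_isBase_superset
  have hβ'E : β' ⊆ M.E := hβ'.subset_ground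
  have hβ'fin : β'.Finite := M.ground_finite.subset hβ'E
  set βF : Finset α := hβ'fin.toFinset with hβF
  have hβFcoe : (βF : Set α) = β' := hβ'fin.coe_toFinset
  have hβFE : βF ⊆ gr M := by
    intro x hx
    rw [hβF, hβ'fin.mem_toFinset] at hx
    rw [← Finset.mem_coe, coe_gr]; exact hβ'E hx
  have hβFcard : βF.card = p := by
    have h1 : (βF.card : ℕ∞) = (p : ℕ∞) := by
      rw [← Set.encard_coe_eq_coe_finsetCard, hβFcoe, hβ'.encard_eq_eRank, hr]
    exact_mod_cast h1
  set B' : Finset α := gr M \ βF with hB'def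
  have hB'coe : (B' : Set α) = M.E \ β' := by rw [hB'def, Finset.coe_sdiff, coe_gr, hβFcoe]
  have hB'sub : (B' : Set α) ⊆ M.E \ A := by
    rw [hB'coe]; exact Set.sdiff_subset_sdiff_right hAβ'
  have hB'mem : B' ∈ PerFlat.Uq M p q := by
    rw [mem_Uq_tight M hn hr]
    refine ⟨Finset.sdiff_subset, hcompl_ind.subset hB'sub, ?_, ?_⟩
    · rw [hB'def, card_sdiff_of_subset hβFE, hn, hβFcard]; omega
    · rw [hB'def, Finset.sdiff_sdiff_eq_self hβFE, hβFcoe]; exact hβ'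
  refine ⟨?_, hcompl_ind⟩
  rw [mem_shadowLev]
  refine ⟨Set.sdiff_subset, ?_, B', hB'mem, hB'sub⟩
  rw [rk_eq_iff M Set.sdiff_subset, hcompl_ind.eRk_eq_encard, ← (M.ground_finite.sdiff).cast_ncard_eq,
    Set.ncard_sdiff hAE hfinA, hEcard, hAcard]

/-- **THE INDEPENDENT SHADOW IS SYMMETRIC ON THE TIGHT LAYER: `i_u = i_{p+q−u}`** (complementation is an
involution between the two levels). -/
theorem card_indepShadow_symm {p q u : ℕ} (hn : (gr M).card = p + q) (hr : M.eRank = (p : ℕ∞))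
    (hu : u ≤ p + q) : (indepShadow M p q u).card = (indepShadow M p q (p + q - u)).card := by
  refine Finset.card_nbij' (fun A => M.E \ A) (fun A => M.E \ A) ?_ ?_ ?_ ?_
  · intro A hA
    rw [Finset.mem_coe] at hA ⊢
    exact compl_mem_indepShadow M hn hr hA
  · intro A hA
    rw [Finset.mem_coe] at hA ⊢
    have h := compl_mem_indepShadow M hn hr hA
    rwa [show p + q - (p + q - u) = u by omega] at h
  · intro A hA
    rw [Finset.mem_coe, mem_indepShadow, mem_shadowLev] at hA
    exact Set.sdiff_sdiff_cancel_left hA.1.1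
  · intro A hA
    rw [Finset.mem_coe, mem_indepShadow, mem_shadowLev] at hA
    exact Set.sdiff_sdiff_cancel_left hA.1.1

/-- On the tight layer the symmetry `s_u ≥ s_{p+q−u}` is exactly the symmetry of the DEPENDENT shadow sets. -/
theorem symm_iff_dep_symm {p q u : ℕ} (hn : (gr M).card = p + q) (hr : M.eRank = (p : ℕ∞))
    (hu : u ≤ p + q) :
    (shadowLev M (p + q - u) (PerFlat.Uq M p q)).card ≤ (shadowLev M u (PerFlat.Uq M p q)).card ↔
      (depShadow M p q (p + q - u)).card ≤ (depShadow M p q u).card := by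
  rw [card_shadowLev_eq_indep_add_dep, card_shadowLev_eq_indep_add_dep, card_indepShadow_symm M hn hr hu]
  omega

/-- **The independent shadow sets of the tight layer are the bipartitions of `E` into two independent sets**:
`A ∈ i_u ⟺ A ⊆ E, |A| = u, A and E ∖ A independent` (a bottom set inside `A` is `E ∖ β` for a base `β ⊇ E ∖ A`). -/
theorem mem_indepShadow_iff_tight {p q u : ℕ} (hn : (gr M).card = p + q) (hr : M.eRank = (p : ℕ∞))
    {A : Set α} : A ∈ indepShadow M p q u ↔ A ⊆ M.E ∧ A.ncard = u ∧ M.Indep A ∧ M.Indep (M.E \ A) := by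
  rw [mem_indepShadow, mem_shadowLev]
  constructor
  · rintro ⟨⟨hAE, hAu, B, hB, hBA⟩, hAind⟩
    have hfinA : A.Finite := M.ground_finite.subset hAE
    rw [mem_Uq_tight M hn hr] at hB
    obtain ⟨-, -, -, hD⟩ := hB
    have hDcoe : ((gr M \ B : Finset α) : Set α) = M.E \ B := by rw [Finset.coe_sdiff, coe_gr]
    have hcompl : M.Indep (M.E \ A) := by
      have := hD.indep
      rw [hDcoe] at this
      exact this.subset (Set.sdiff_subset_sdiff_right hBA)
    have hAcard : A.ncard = u := by
      have h1 := hAind.eRk_eq_encard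
      rw [eRk_eq_coe_rk M hAE, hAu, ← hfinA.cast_ncard_eq] at h1
      exact_mod_cast h1.symm
    exact ⟨hAE, hAcard, hAind, hcompl⟩
  · rintro ⟨hAE, hAu, hAind, hcompl⟩
    have hfinA : A.Finite := M.ground_finite.subset hAE
    refine ⟨⟨hAE, ?_, ?_⟩, hAind⟩
    · rw [rk_eq_iff M hAE, hAind.eRk_eq_encard, ← hfinA.cast_ncard_eq, hAu]
    · -- a base `β ⊇ E ∖ A`; `E ∖ β ⊆ A` is a bottom set
      obtain ⟨β, hβ, hβA⟩ := hcompl.exists_isBase_superset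
      have hβE : β ⊆ M.E := hβ.subset_ground
      have hβfin : β.Finite := M.ground_finite.subset hβE
      set βF : Finset α := hβfin.toFinset with hβF
      have hβFcoe : (βF : Set α) = β := hβfin.coe_toFinset
      have hβFE : βF ⊆ gr M := by
        intro x hx
        rw [hβF, hβfin.mem_toFinset] at hx
        rw [← Finset.mem_coe, coe_gr]; exact hβE hx
      have hβFcard : βF.card = p := by
        have h1 : (βF.card : ℕ∞) = (p : ℕ∞) := by
          rw [← Set.encard_coe_eq_coe_finsetCard, hβFcoe, hβ.encard_eq_eRank, hr]
        exact_mod_cast h1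
      set B : Finset α := gr M \ βF with hBdef
      have hBcoe : (B : Set α) = M.E \ β := by rw [hBdef, Finset.coe_sdiff, coe_gr, hβFcoe]
      have hBA : (B : Set α) ⊆ A := by
        rw [hBcoe]
        intro x hx
        by_contra hxA
        exact hx.2 (hβA ⟨hx.1, hxA⟩)
      refine ⟨B, ?_, hBA⟩
      rw [mem_Uq_tight M hn hr]
      refine ⟨Finset.sdiff_subset, hAind.subset hBA, ?_, ?_⟩
      · rw [hBdef, card_sdiff_of_subset hβFE, hn, hβFcard]; omega
      · rw [hBdef, Finset.sdiff_sdiff_eq_self hβFE, hβFcoe]; exact hβ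

end PercRepro.RankDist
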